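import Mathlib.NumberTheory.Padics.Hensel
import Literature.NumberTheory.QuadraticFields.Sqrt73
import Literature.NumberTheory.QuadraticFields.Sqrt41Places
import HarnessLib

/-!
# The real quadratic field `ℚ(√73)`, II: the places above `2`, `3`, `5` and the square theorem

Continuation of `Sqrt73.lean` (`K = ℚ(√73)` as `QuadraticAlgebra ℚ 73 0`, class number one,
totally positive units are squares), towards the complete `2`-descent of `E = 480a1` over `K`
(T. Dokchitser–V. Dokchitser, *A note on the Mordell–Weil rank modulo n*, J. Number Theory 131
(2011), proof of Thm. 2). The bad primes of `E` are `2, 3, 5`; in `K`, `2 = π₂ π₂'` and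
`3 = π₃ π₃''` split (`73 ≡ 1 mod 8`, `73 ≡ 1 mod 3`) and `5` is inert. Everything is PROVED:

* `sqrt73Two : ℤ₂`, `sqrt73Three : ℤ₃` — square roots of `73` (Hensel) with
  `√73 ≡ 29 (mod 64)` in `ℤ₂` and `√73 ≡ 1 (mod 9)` in `ℤ₃`; the embeddings
  `ι± : K →ₐ[ℚ] ℚ₂`, `κ± : K →ₐ[ℚ] ℚ₃` (`√73 ↦ ±√73`);
* the primes: `(π₂), (π₂')` above `2` and `(π₃), (π₃'')` above `3` (from part I), `(5)` (inert:
  `eq_span_five`), and the dictionary with the embeddings: `ord_(π₂) = v₂ ∘ ι⁻`,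
  `ord_(π₂') = v₂ ∘ ι⁺`, `ord_(π₃) = v₃ ∘ κ⁻`, `ord_(π₃'') = v₃ ∘ κ⁺`
  (`PadicEmbeddingValuation.lean`), `ord_(5) = v₅ ∘ N / 2`;
* **the square theorem in local terms** (`exists_sq_eq_of_local_data`): `z ∈ Kˣ` with even
  valuation at all primes not dividing `30`, even `2`-adic valuation under both `ι±`, even
  `3`-adic valuation under both `κ±`, `4 ∣ v₅(N z)`, and positive under both real embeddings, is
  a square.

## References

* T. Dokchitser, V. Dokchitser, *A note on the Mordell–Weil rank modulo n*, J. Number Theory 131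
  (2011) 1833–1839, proof of Thm. 2. [DokchitserDokchitser2011RankModN]
* J. Neukirch, *Algebraic Number Theory* (1999), Ch. II §8; D. A. Marcus, *Number Fields*,
  Ch. 3 (splitting of primes in quadratic fields). [folklore]
-/

noncomputable section

open scoped Classical

open Module NumberField QuadraticAlgebra IsDedekindDomain IsDedekindDomain.HeightOneSpectrum WithZero
open Literature.NumberTheory.NumberFields
open Literature.NumberTheory.QuadraticFields.Sqrt41 (norm_two_two val_toZModPow_mod norm_add_mul_eq_one
  valuation_two' valuation_neg'')

namespace Literature.NumberTheory.QuadraticFields.Sqrt73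

/-! ### Square roots of `73` in `ℤ₂` and `ℤ₃` -/

/-- The polynomial `X² - 73 ∈ ℤ[X]` and its values. [folklore] -/
theorem aeval_sq_sub {R : Type*} [CommRing R] (x : R) :
    (Polynomial.X ^ 2 - 73 : Polynomial ℤ).aeval x = x ^ 2 - 73 := by
  simp [map_ofNat]

/-- The derivative `2X` of `X² - 73` and its values. [folklore] -/
theorem aeval_derivative_sq_sub {R : Type*} [CommRing R] (x : R) :
    (Polynomial.derivative (Polynomial.X ^ 2 - 73 : Polynomial ℤ)).aeval x = 2 * x := by
  simp [map_ofNat]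

/-- `‖29‖ = ‖3‖ = 1` in `ℤ₂`. [folklore] -/
theorem norm_units_two : ‖(29 : ℤ_[2])‖ = 1 ∧ ‖(3 : ℤ_[2])‖ = 1 := by
  constructor
  · rw [show (29 : ℤ_[2]) = ((29 : ℕ) : ℤ_[2]) by norm_num, PadicInt.norm_natCast_eq_one_iff]; decide
  · rw [show (3 : ℤ_[2]) = ((3 : ℕ) : ℤ_[2]) by norm_num, PadicInt.norm_natCast_eq_one_iff]; decide

/-- **`73` is a `2`-adic square**: there is `r ∈ ℤ₂` with `r² = 73` and `‖r - 29‖ < 1/2`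
(Hensel at `a = 29`: `29² - 73 = 2⁸·3`, `‖2·29‖² = 1/4`). [folklore] -/
theorem exists_sqrt73_two : ∃ r : ℤ_[2], r ^ 2 = 73 ∧ ‖r - 29‖ < 1 / 2 := by
  have hder : ‖(Polynomial.derivative (Polynomial.X ^ 2 - 73 : Polynomial ℤ)).aeval (29 : ℤ_[2])‖ =
      1 / 2 := by
    rw [aeval_derivative_sq_sub, norm_mul, norm_two_two, norm_units_two.1]; norm_num
  have hF : ‖(Polynomial.X ^ 2 - 73 : Polynomial ℤ).aeval (29 : ℤ_[2])‖ <
      ‖(Polynomial.derivative (Polynomial.X ^ 2 - 73 : Polynomial ℤ)).aeval (29 : ℤ_[2])‖ ^ 2 := by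
    rw [hder, aeval_sq_sub, show (29 : ℤ_[2]) ^ 2 - 73 = 2 ^ 8 * 3 by norm_num, norm_mul, norm_pow,
      norm_two_two, norm_units_two.2]
    norm_num
  obtain ⟨r, hr, hdist, -, -⟩ := hensels_lemma hF
  refine ⟨r, ?_, ?_⟩
  · rw [aeval_sq_sub] at hr
    linear_combination hr
  · rwa [hder] at hdist

/-- `√73 ∈ ℤ₂`, the root `≡ 1 (mod 4)` (in fact `≡ 29 (mod 64)`). [folklore] -/
def sqrt73Two : ℤ_[2] := Classical.choose exists_sqrt73_two

/-- `sqrt73Two² = 73`. [folklore] -/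
theorem sqrt73Two_sq : sqrt73Two ^ 2 = 73 := (Classical.choose_spec exists_sqrt73_two).1

/-- `‖sqrt73Two - 29‖ < 1/2`. [folklore] -/
theorem norm_sqrt73Two_sub : ‖sqrt73Two - 29‖ < 1 / 2 := (Classical.choose_spec exists_sqrt73_two).2

/-- `sqrt73Two ≡ 29 ≡ 1 (mod 4)`. [folklore] -/
theorem toZModPow_two_sqrt73Two : PadicInt.toZModPow 2 sqrt73Two = 29 := by
  have h : sqrt73Two - 29 ∈ Ideal.span {((2 : ℕ) : ℤ_[2]) ^ 2} := by
    rw [← PadicInt.norm_le_pow_iff_mem_span_pow]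
    have h' : ‖sqrt73Two - 29‖ < ((2 : ℕ) : ℝ) ^ (-(1 : ℤ)) := by
      have := norm_sqrt73Two_sub; norm_num; linarith
    have h'' := (PadicInt.norm_lt_pow_iff_norm_le_pow_sub_one _ _).mp h'
    have e : ((-1 : ℤ) - 1) = -((2 : ℕ) : ℤ) := by norm_num
    rwa [e] at h''
  rw [← PadicInt.ker_toZModPow, RingHom.mem_ker, map_sub] at h
  have h29 : PadicInt.toZModPow 2 (29 : ℤ_[2]) = 29 := by
    rw [show (29 : ℤ_[2]) = ((29 : ℕ) : ℤ_[2]) by norm_num, map_natCast]; rfl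
  rw [h29] at h
  exact sub_eq_zero.mp h

set_option maxRecDepth 20000 in
/-- In `ℤ/128`: a square root of `73` which is `1 mod 4` is `29 mod 64`. [folklore] -/
theorem zmod128_sqrt73 : ∀ s : ZMod 128, s ^ 2 = 73 → s.val % 4 = 1 → s.val % 64 = 29 := by
  decide

/-- **`√73 ≡ 29 (mod 64)` in `ℤ₂`.** [folklore] -/
theorem toZModPow_six_sqrt73Two : PadicInt.toZModPow 6 sqrt73Two = 29 := by
  have hsq : (PadicInt.toZModPow 7 sqrt73Two) ^ 2 = 73 := by
    rw [← map_pow, sqrt73Two_sq, show (73 : ℤ_[2]) = ((73 : ℕ) : ℤ_[2]) by norm_num, map_natCast]; rfl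
  have h4 : (PadicInt.toZModPow 7 sqrt73Two).val % 4 = 1 := by
    have := val_toZModPow_mod 2 7 (by norm_num) sqrt73Two
    rw [toZModPow_two_sqrt73Two] at this
    exact this.trans (by decide)
  have h64 := zmod128_sqrt73 _ hsq h4
  have h6 := val_toZModPow_mod 6 7 (by norm_num) sqrt73Two
  have h6' : (PadicInt.toZModPow 6 sqrt73Two).val = 29 := by rw [← h6]; exact h64
  apply ZMod.val_injective
  rw [h6']
  decide

/-- `‖2‖ = 1` and `‖72‖ = 1/9` in `ℤ₃`. [folklore] -/
theorem norm_two_three : ‖(2 : ℤ_[3])‖ = 1 ∧ ‖(72 : ℤ_[3])‖ = 3⁻¹ * 3⁻¹ := by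
  constructor
  · rw [show (2 : ℤ_[3]) = ((2 : ℕ) : ℤ_[3]) by norm_num, PadicInt.norm_natCast_eq_one_iff]; decide
  · rw [show (72 : ℤ_[3]) = (3 : ℤ_[3]) * 3 * 8 by norm_num, norm_mul, norm_mul]
    have h3 : ‖(3 : ℤ_[3])‖ = 3⁻¹ := by have := @PadicInt.norm_p 3 _; simpa using this
    have h8 : ‖(8 : ℤ_[3])‖ = 1 := by
      rw [show (8 : ℤ_[3]) = ((8 : ℕ) : ℤ_[3]) by norm_num, PadicInt.norm_natCast_eq_one_iff]; decide
    rw [h3, h8, mul_one]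

/-- **`73` is a `3`-adic square**: `r ∈ ℤ₃`, `r² = 73`, `‖r - 1‖ < 1` (Hensel at `a = 1`:
`1 - 73 = -72`, `‖2‖ = 1`). [folklore] -/
theorem exists_sqrt73_three : ∃ r : ℤ_[3], r ^ 2 = 73 ∧ ‖r - 1‖ < 1 := by
  have hder : ‖(Polynomial.derivative (Polynomial.X ^ 2 - 73 : Polynomial ℤ)).aeval (1 : ℤ_[3])‖ = 1 := by
    rw [aeval_derivative_sq_sub, mul_one, norm_two_three.1]
  have hF : ‖(Polynomial.X ^ 2 - 73 : Polynomial ℤ).aeval (1 : ℤ_[3])‖ <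
      ‖(Polynomial.derivative (Polynomial.X ^ 2 - 73 : Polynomial ℤ)).aeval (1 : ℤ_[3])‖ ^ 2 := by
    rw [hder, aeval_sq_sub, show (1 : ℤ_[3]) ^ 2 - 73 = -72 by norm_num, _root_.norm_neg, norm_two_three.2]
    norm_num
  obtain ⟨r, hr, hdist, -, -⟩ := hensels_lemma hF
  refine ⟨r, ?_, ?_⟩
  · rw [aeval_sq_sub] at hr
    linear_combination hr
  · rwa [hder] at hdist

/-- `√73 ∈ ℤ₃`, the root `≡ 1 (mod 3)` (in fact `≡ 10 (mod 27)`). [folklore] -/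
def sqrt73Three : ℤ_[3] := Classical.choose exists_sqrt73_three

/-- `sqrt73Three² = 73`. [folklore] -/
theorem sqrt73Three_sq : sqrt73Three ^ 2 = 73 := (Classical.choose_spec exists_sqrt73_three).1

/-- `‖sqrt73Three - 1‖ < 1`. [folklore] -/
theorem norm_sqrt73Three_sub : ‖sqrt73Three - 1‖ < 1 := (Classical.choose_spec exists_sqrt73_three).2

/-- `sqrt73Three ≡ 1 (mod 3)`. [folklore] -/
theorem toZModPow_one_sqrt73Three : PadicInt.toZModPow 1 sqrt73Three = 1 := by
  have h : sqrt73Three - 1 ∈ Ideal.span {((3 : ℕ) : ℤ_[3]) ^ 1} := by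
    rw [← PadicInt.norm_le_pow_iff_mem_span_pow]
    have h' : ‖sqrt73Three - 1‖ < ((3 : ℕ) : ℝ) ^ (0 : ℤ) := by
      rw [zpow_zero]; exact norm_sqrt73Three_sub
    have h'' := (PadicInt.norm_lt_pow_iff_norm_le_pow_sub_one _ _).mp h'
    have e : ((0 : ℤ) - 1) = -((1 : ℕ) : ℤ) := by norm_num
    rwa [e] at h''
  rw [← PadicInt.ker_toZModPow, RingHom.mem_ker, map_sub, map_one] at h
  exact sub_eq_zero.mp h

/-- In `ℤ/27`: a square root of `73` which is `1 mod 3` is `1 mod 9` (it is `10`). [folklore] -/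
theorem zmod27_sqrt73 : ∀ s : ZMod 27, s ^ 2 = 73 → s.val % 3 = 1 → s.val % 9 = 1 := by
  decide

/-- **`√73 ≡ 1 (mod 9)` in `ℤ₃`.** [folklore] -/
theorem toZModPow_two_sqrt73Three : PadicInt.toZModPow 2 sqrt73Three = 1 := by
  have hsq : (PadicInt.toZModPow 3 sqrt73Three) ^ 2 = 73 := by
    rw [← map_pow, sqrt73Three_sq, show (73 : ℤ_[3]) = ((73 : ℕ) : ℤ_[3]) by norm_num, map_natCast]; rfl
  have h1 : (PadicInt.toZModPow 3 sqrt73Three).val % 3 = 1 := by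
    have := val_toZModPow_mod 1 3 (by norm_num) sqrt73Three
    rw [toZModPow_one_sqrt73Three] at this
    exact this.trans (by decide)
  have h9 := zmod27_sqrt73 _ hsq h1
  have h2 := val_toZModPow_mod 2 3 (by norm_num) sqrt73Three
  have h2' : (PadicInt.toZModPow 2 sqrt73Three).val = 1 := by rw [← h2]; exact h9
  apply ZMod.val_injective
  rw [h2']
  decide

/-! ### Expansions of the roots -/

/-- `√73 = 29 + 64 t` in `ℤ₂`. [folklore] -/
theorem exists_sqrt73Two_eq : ∃ t : ℤ_[2], sqrt73Two = 29 + 2 ^ 6 * t := by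
  have h : sqrt73Two - 29 ∈ RingHom.ker (PadicInt.toZModPow 6 : ℤ_[2] →+* ZMod (2 ^ 6)) := by
    rw [RingHom.mem_ker, map_sub, toZModPow_six_sqrt73Two,
      show (29 : ℤ_[2]) = ((29 : ℕ) : ℤ_[2]) by norm_num, map_natCast]
    decide
  rw [PadicInt.ker_toZModPow, Ideal.mem_span_singleton'] at h
  obtain ⟨t, ht⟩ := h
  exact ⟨t, by rw [Nat.cast_ofNat] at ht; linear_combination -ht⟩

/-- `√73 = 1 + 9 t` in `ℤ₃`. [folklore] -/
theorem exists_sqrt73Three_eq : ∃ t : ℤ_[3], sqrt73Three = 1 + 3 ^ 2 * t := by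
  have h : sqrt73Three - 1 ∈ RingHom.ker (PadicInt.toZModPow 2 : ℤ_[3] →+* ZMod (3 ^ 2)) := by
    rw [RingHom.mem_ker, map_sub, toZModPow_two_sqrt73Three, map_one, sub_self]
  rw [PadicInt.ker_toZModPow, Ideal.mem_span_singleton'] at h
  obtain ⟨t, ht⟩ := h
  exact ⟨t, by rw [Nat.cast_ofNat] at ht; linear_combination -ht⟩

/-! ### The embeddings `K → ℚ₂`, `K → ℚ₃` -/

/-- A square root `u` of `73` in a `ℚ`-algebra, as a root datum for `QuadraticAlgebra.lift`.
[folklore] -/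
def rootDatum {A : Type*} [Ring A] [Algebra ℚ A] (u : A) (hu : u * u = 73) :
    {u : A // u * u = (73 : ℚ) • (1 : A) + (0 : ℚ) • u} :=
  ⟨u, by rw [zero_smul, add_zero, Algebra.smul_def, mul_one, map_ofNat]; exact hu⟩

/-- `sqrt73Two * sqrt73Two = 73` in `ℚ₂`. [folklore] -/
theorem sqrt73Two_mul_self : (sqrt73Two : ℚ_[2]) * sqrt73Two = 73 := by
  have := congrArg ((↑) : ℤ_[2] → ℚ_[2]) sqrt73Two_sq
  push_cast at this
  rw [← sq]; exact this

/-- `sqrt73Three * sqrt73Three = 73` in `ℚ₃`. [folklore] -/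
theorem sqrt73Three_mul_self : (sqrt73Three : ℚ_[3]) * sqrt73Three = 73 := by
  have := congrArg ((↑) : ℤ_[3] → ℚ_[3]) sqrt73Three_sq
  push_cast at this
  rw [← sq]; exact this

/-- The embedding `ι⁺ : K → ℚ₂`, `√73 ↦ sqrt73Two`. [folklore] -/
def ιpos : K →ₐ[ℚ] ℚ_[2] := QuadraticAlgebra.lift (rootDatum (sqrt73Two : ℚ_[2]) sqrt73Two_mul_self)

/-- The embedding `ι⁻ : K → ℚ₂`, `√73 ↦ -sqrt73Two`. [folklore] -/
def ιneg : K →ₐ[ℚ] ℚ_[2] :=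
  QuadraticAlgebra.lift (rootDatum (-(sqrt73Two : ℚ_[2])) (by rw [neg_mul_neg, sqrt73Two_mul_self]))

/-- The embedding `κ⁺ : K → ℚ₃`, `√73 ↦ sqrt73Three`. [folklore] -/
def κpos : K →ₐ[ℚ] ℚ_[3] := QuadraticAlgebra.lift (rootDatum (sqrt73Three : ℚ_[3]) sqrt73Three_mul_self)

/-- The embedding `κ⁻ : K → ℚ₃`, `√73 ↦ -sqrt73Three`. [folklore] -/
def κneg : K →ₐ[ℚ] ℚ_[3] :=
  QuadraticAlgebra.lift (rootDatum (-(sqrt73Three : ℚ_[3])) (by rw [neg_mul_neg, sqrt73Three_mul_self]))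

/-- `ι⁺ (x + y√73) = x + y · sqrt73Two`. [folklore] -/
theorem ιpos_apply (z : K) : ιpos z = (z.re : ℚ_[2]) + (z.im : ℚ_[2]) * sqrt73Two := by
  change z.re • (1 : ℚ_[2]) + z.im • (sqrt73Two : ℚ_[2]) = _
  rw [Rat.smul_one_eq_cast, Rat.smul_def]

/-- `ι⁻ (x + y√73) = x - y · sqrt73Two`. [folklore] -/
theorem ιneg_apply (z : K) : ιneg z = (z.re : ℚ_[2]) - (z.im : ℚ_[2]) * sqrt73Two := by
  change z.re • (1 : ℚ_[2]) + z.im • (-(sqrt73Two : ℚ_[2])) = _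
  rw [Rat.smul_one_eq_cast, Rat.smul_def]; ring

/-- `κ⁺ (x + y√73) = x + y · sqrt73Three`. [folklore] -/
theorem κpos_apply (z : K) : κpos z = (z.re : ℚ_[3]) + (z.im : ℚ_[3]) * sqrt73Three := by
  change z.re • (1 : ℚ_[3]) + z.im • (sqrt73Three : ℚ_[3]) = _
  rw [Rat.smul_one_eq_cast, Rat.smul_def]

/-- `κ⁻ (x + y√73) = x - y · sqrt73Three`. [folklore] -/
theorem κneg_apply (z : K) : κneg z = (z.re : ℚ_[3]) - (z.im : ℚ_[3]) * sqrt73Three := by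
  change z.re • (1 : ℚ_[3]) + z.im • (-(sqrt73Three : ℚ_[3])) = _
  rw [Rat.smul_one_eq_cast, Rat.smul_def]; ring

/-! ### The element `θ = √73` of `𝓞 K`; `π₃ = 17 + 2θ`, `π₃'' = 2θ - 17` -/

/-- `θ = √73 = 2φ - 1` as an algebraic integer. [folklore] -/
def θint : 𝓞 K := 2 * φint - 1

/-- `(θint : K) = θ`. [folklore] -/
@[simp] theorem coe_θint : ((θint : 𝓞 K) : K) = θ := by
  simp only [θint, map_sub, map_mul, map_ofNat, map_one, coe_φint]
  rw [two_mul_φ]; ring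

/-- `θ² = 73` in `𝓞 K`. [folklore] -/
theorem θint_sq : (θint : 𝓞 K) ^ 2 = 73 := by
  unfold θint
  linear_combination (4 : 𝓞 K) * φint_sq

/-- `π₃ = 17 + 2θ` in `K`. [folklore] -/
theorem coe_π₃_θ : ((π₃ : 𝓞 K) : K) = 17 + 2 * θ := by
  rw [coe_π₃]; ext <;> simp [φ, θ] <;> norm_num

/-- `π₃'' = 2θ - 17` in `K`. [folklore] -/
theorem coe_π₃''_θ : ((π₃'' : 𝓞 K) : K) = 2 * θ - 17 := by
  rw [coe_π₃'']; ext <;> simp [φ, θ] <;> norm_num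

/-! ### The inert prime `5` -/

/-- `5` is inert: `X² - X - 18` has no root modulo `5`. [folklore] -/
theorem no_root_mod_five : ∀ a : ZMod 5, a ^ 2 + ((-1 : ℤ) : ZMod 5) * a + ((-18 : ℤ) : ZMod 5) ≠ 0 := by
  decide

/-- **`5` is inert in `K`: every prime containing `5` is `(5)`** (`X² - X - 18` has no root mod
`5`; norms: `N(P) ∣ 25`, `N(P) = 5` would give a root in `𝓞 K/P ≅ 𝔽₅`). Adapted from the tree's
`isPrincipal_of_mem_primesOver_of_no_root`. [folklore] -/
theorem eq_span_five {P : Ideal (𝓞 K)} (hP : P.IsPrime) (h5 : (5 : 𝓞 K) ∈ P) :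
    P = Ideal.span {(5 : 𝓞 K)} := by
  have hle : Ideal.span {(5 : 𝓞 K)} ≤ P := (Ideal.span_singleton_le_iff_mem _).mpr h5
  have hNp : Ideal.absNorm (Ideal.span {(5 : 𝓞 K)}) = 5 ^ 2 := by
    rw [show (5 : 𝓞 K) = ((5 : ℕ) : 𝓞 K) by norm_num, Ideal.absNorm_span_natCast,
      NumberField.RingOfIntegers.rank, finrank_eq_two]
  have hdvd : Ideal.absNorm P ∣ 5 ^ 2 := hNp ▸ Ideal.absNorm_dvd_absNorm_of_le hle
  have hprime5 : Nat.Prime 5 := by norm_num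
  obtain ⟨k, hk, hkeq⟩ := (Nat.dvd_prime_pow hprime5).mp hdvd
  interval_cases k
  · rw [pow_zero, Ideal.absNorm_eq_one_iff] at hkeq
    exact absurd hkeq hP.ne_top
  · exfalso
    rw [pow_one] at hkeq
    have hcard : Nat.card (𝓞 K ⧸ P) = 5 := by
      rw [← Submodule.cardQuot_apply, ← Ideal.absNorm_apply, hkeq]
    haveI : Finite (𝓞 K ⧸ P) := Nat.finite_of_card_ne_zero (by rw [hcard]; norm_num)
    letI : Fintype (𝓞 K ⧸ P) := Fintype.ofFinite _
    have hcard' : Fintype.card (𝓞 K ⧸ P) = 5 := by rw [← Nat.card_eq_fintype_card, hcard]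
    let e : ZMod 5 ≃+* 𝓞 K ⧸ P := ZMod.ringEquivOfPrime (𝓞 K ⧸ P) hprime5 hcard'
    refine no_root_mod_five (e.symm (Ideal.Quotient.mk P φint)) ?_
    have h := congrArg (fun x : 𝓞 K => e.symm (Ideal.Quotient.mk P x)) φint_rel
    simpa [map_ofNat] using h
  · obtain ⟨J, hJ⟩ := Ideal.dvd_iff_le.mpr hle
    have hJ1 : Ideal.absNorm J = 1 := by
      have h := congrArg Ideal.absNorm hJ
      rw [map_mul, hNp, hkeq] at h
      nlinarith [h]
    rw [Ideal.absNorm_eq_one_iff] at hJ1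
    rw [hJ1, Ideal.mul_top] at hJ
    exact hJ.symm

/-- `(5)` is a maximal ideal of `𝓞 K`. [folklore] -/
theorem span_five_isMaximal : (Ideal.span {(5 : 𝓞 K)}).IsMaximal := by
  have hne : Ideal.span {(5 : 𝓞 K)} ≠ ⊤ := by
    intro h
    have := congrArg Ideal.absNorm h
    rw [show (5 : 𝓞 K) = ((5 : ℕ) : 𝓞 K) by norm_num, Ideal.absNorm_span_natCast,
      NumberField.RingOfIntegers.rank, finrank_eq_two, Ideal.absNorm_top] at this
    norm_num at this
  obtain ⟨M, hM, hle⟩ := Ideal.exists_le_maximal _ hne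
  have h5 : (5 : 𝓞 K) ∈ M := hle (Ideal.mem_span_singleton_self _)
  rw [← eq_span_five hM.isPrime h5]
  exact hM

/-- `5` is a prime element of `𝓞 K`. [folklore] -/
theorem prime_five : Prime (5 : 𝓞 K) :=
  (Ideal.span_singleton_prime (by norm_num)).mp span_five_isMaximal.isPrime

/-! ### Valuations of the prime elements under the embeddings -/

/-- `v₃(3) = 1` in `ℚ₃`. [folklore] -/
theorem valuation_three' : (3 : ℚ_[3]).valuation = 1 := by
  have h := @Padic.valuation_p 3 _
  rwa [Nat.cast_ofNat] at h

/-- Units and non-units among small naturals in `ℚ₂` and `ℚ₃`. [folklore] -/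
theorem norm_natCast_units :
    ‖((5 : ℕ) : ℚ_[2])‖ = 1 ∧ ‖((16 : ℕ) : ℚ_[2])‖ < 1 ∧ ‖((5 : ℕ) : ℚ_[3])‖ = 1 ∧ ‖((6 : ℕ) : ℚ_[3])‖ < 1 := by
  refine ⟨?_, ?_, ?_, ?_⟩
  · rw [Padic.norm_natCast_eq_one_iff]; decide
  · rw [Padic.norm_natCast_lt_one_iff]; decide
  · rw [Padic.norm_natCast_eq_one_iff]; decide
  · rw [Padic.norm_natCast_lt_one_iff]; decide

/-- The coercion of `√73 = 29 + 64t` to `ℚ₂`. [folklore] -/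
theorem coe_sqrt73Two_eq {t : ℤ_[2]} (ht : sqrt73Two = 29 + 2 ^ 6 * t) :
    ((sqrt73Two : ℤ_[2]) : ℚ_[2]) = 29 + 64 * (t : ℚ_[2]) := by
  rw [ht, PadicInt.coe_add, PadicInt.coe_mul, PadicInt.coe_pow,
    show (29 : ℤ_[2]) = ((29 : ℕ) : ℤ_[2]) by norm_num, show (2 : ℤ_[2]) = ((2 : ℕ) : ℤ_[2]) by norm_num,
    PadicInt.coe_natCast, PadicInt.coe_natCast]
  norm_num

/-- The coercion of `√73 = 1 + 9t` to `ℚ₃`. [folklore] -/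
theorem coe_sqrt73Three_eq {t : ℤ_[3]} (ht : sqrt73Three = 1 + 3 ^ 2 * t) :
    ((sqrt73Three : ℤ_[3]) : ℚ_[3]) = 1 + 9 * (t : ℚ_[3]) := by
  rw [ht, PadicInt.coe_add, PadicInt.coe_mul, PadicInt.coe_pow, PadicInt.coe_one,
    show (3 : ℤ_[3]) = ((3 : ℕ) : ℤ_[3]) by norm_num, PadicInt.coe_natCast]
  norm_num

/-- **`v₂(ι⁻ π₂) = 1`**: `ι⁻ π₂ = (9 - √73)/2 = -2(5 + 16t)`. [folklore] -/
theorem valuation_ιneg_π₂ : (ιneg ((π₂ : 𝓞 K) : K)).valuation = 1 := by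
  obtain ⟨t, ht⟩ := exists_sqrt73Two_eq
  have e : ιneg ((π₂ : 𝓞 K) : K) = 2 * -(((5 : ℕ) : ℚ_[2]) + ((16 : ℕ) : ℚ_[2]) * (t : ℚ_[2])) := by
    rw [coe_π₂, map_add, map_ofNat, ιneg_apply, φ_re, φ_im, coe_sqrt73Two_eq ht]
    push_cast; ring
  have hn := norm_add_mul_eq_one norm_natCast_units.1 t norm_natCast_units.2.1
  have hne : ((5 : ℕ) : ℚ_[2]) + ((16 : ℕ) : ℚ_[2]) * (t : ℚ_[2]) ≠ 0 := by
    intro h0; rw [h0, _root_.norm_zero] at hn; exact zero_ne_one hn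
  rw [e, Padic.valuation_mul two_ne_zero (neg_ne_zero.mpr hne), valuation_two', valuation_neg'',
    valuation_eq_zero_of_norm_eq_one hn]
  rfl

/-- **`v₂(ι⁺ π₂') = 1`**: `ι⁺ π₂' = (9 - √73)/2` as well. [folklore] -/
theorem valuation_ιpos_π₂' : (ιpos ((π₂' : 𝓞 K) : K)).valuation = 1 := by
  obtain ⟨t, ht⟩ := exists_sqrt73Two_eq
  have e : ιpos ((π₂' : 𝓞 K) : K) = 2 * -(((5 : ℕ) : ℚ_[2]) + ((16 : ℕ) : ℚ_[2]) * (t : ℚ_[2])) := by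
    rw [coe_π₂', map_sub, map_ofNat, ιpos_apply, φ_re, φ_im, coe_sqrt73Two_eq ht]
    push_cast; ring
  have hn := norm_add_mul_eq_one norm_natCast_units.1 t norm_natCast_units.2.1
  have hne : ((5 : ℕ) : ℚ_[2]) + ((16 : ℕ) : ℚ_[2]) * (t : ℚ_[2]) ≠ 0 := by
    intro h0; rw [h0, _root_.norm_zero] at hn; exact zero_ne_one hn
  rw [e, Padic.valuation_mul two_ne_zero (neg_ne_zero.mpr hne), valuation_two', valuation_neg'',
    valuation_eq_zero_of_norm_eq_one hn]
  rfl

/-- **`v₃(κ⁻ π₃) = 1`**: `κ⁻ π₃ = 17 - 2√73 = 3(5 - 6t)`. [folklore] -/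
theorem valuation_κneg_π₃ : (κneg ((π₃ : 𝓞 K) : K)).valuation = 1 := by
  obtain ⟨t, ht⟩ := exists_sqrt73Three_eq
  have e : κneg ((π₃ : 𝓞 K) : K) = 3 * (((5 : ℕ) : ℚ_[3]) + (-((6 : ℕ) : ℚ_[3])) * (t : ℚ_[3])) := by
    rw [coe_π₃_θ, map_add, map_mul, map_ofNat, map_ofNat, κneg_apply, θ_re, θ_im, coe_sqrt73Three_eq ht]
    push_cast; ring
  have hn := norm_add_mul_eq_one norm_natCast_units.2.2.1 t
    (by rw [_root_.norm_neg]; exact norm_natCast_units.2.2.2)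
  have hne : ((5 : ℕ) : ℚ_[3]) + (-((6 : ℕ) : ℚ_[3])) * (t : ℚ_[3]) ≠ 0 := by
    intro h0; rw [h0, _root_.norm_zero] at hn; exact zero_ne_one hn
  have h3 : (3 : ℚ_[3]) ≠ 0 := by norm_num
  rw [e, Padic.valuation_mul h3 hne, valuation_three', valuation_eq_zero_of_norm_eq_one hn]
  rfl

/-- **`v₃(κ⁺ π₃'') = 1`**: `κ⁺ π₃'' = 2√73 - 17 = -3(5 - 6t)`. [folklore] -/
theorem valuation_κpos_π₃'' : (κpos ((π₃'' : 𝓞 K) : K)).valuation = 1 := by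
  obtain ⟨t, ht⟩ := exists_sqrt73Three_eq
  have e : κpos ((π₃'' : 𝓞 K) : K) = 3 * -(((5 : ℕ) : ℚ_[3]) + (-((6 : ℕ) : ℚ_[3])) * (t : ℚ_[3])) := by
    rw [coe_π₃''_θ, map_sub, map_mul, map_ofNat, map_ofNat, κpos_apply, θ_re, θ_im, coe_sqrt73Three_eq ht]
    push_cast; ring
  have hn := norm_add_mul_eq_one norm_natCast_units.2.2.1 t
    (by rw [_root_.norm_neg]; exact norm_natCast_units.2.2.2)
  have hne : ((5 : ℕ) : ℚ_[3]) + (-((6 : ℕ) : ℚ_[3])) * (t : ℚ_[3]) ≠ 0 := by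
    intro h0; rw [h0, _root_.norm_zero] at hn; exact zero_ne_one hn
  have h3 : (3 : ℚ_[3]) ≠ 0 := by norm_num
  rw [e, Padic.valuation_mul h3 (neg_ne_zero.mpr hne), valuation_three', valuation_neg'',
    valuation_eq_zero_of_norm_eq_one hn]
  rfl

/-! ### The dictionary: `ord_𝔭 = v_p ∘ embedding` at the split primes -/

/-- `ord_(π₂) z = v₂(ι⁻ z)`. [folklore] -/
theorem log_valuation_span_π₂ (v : HeightOneSpectrum (𝓞 K)) (hv : v.asIdeal = Ideal.span {π₂})
    {z : K} (hz : z ≠ 0) : log (v.valuation K z) = -(ιneg z).valuation :=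
  log_valuation_eq_neg_valuation_embedding (ιneg : K →ₐ[ℚ] ℚ_[2]).toRingHom span_π₂_isMaximal
    valuation_ιneg_π₂ v hv hz

/-- `ord_(π₂') z = v₂(ι⁺ z)`. [folklore] -/
theorem log_valuation_span_π₂' (v : HeightOneSpectrum (𝓞 K)) (hv : v.asIdeal = Ideal.span {π₂'})
    {z : K} (hz : z ≠ 0) : log (v.valuation K z) = -(ιpos z).valuation :=
  log_valuation_eq_neg_valuation_embedding (ιpos : K →ₐ[ℚ] ℚ_[2]).toRingHom span_π₂'_isMaximal
    valuation_ιpos_π₂' v hv hz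

/-- `ord_(π₃) z = v₃(κ⁻ z)`. [folklore] -/
theorem log_valuation_span_π₃ (v : HeightOneSpectrum (𝓞 K)) (hv : v.asIdeal = Ideal.span {π₃})
    {z : K} (hz : z ≠ 0) : log (v.valuation K z) = -(κneg z).valuation :=
  log_valuation_eq_neg_valuation_embedding (κneg : K →ₐ[ℚ] ℚ_[3]).toRingHom span_π₃_isMaximal
    valuation_κneg_π₃ v hv hz

/-- `ord_(π₃'') z = v₃(κ⁺ z)`. [folklore] -/
theorem log_valuation_span_π₃'' (v : HeightOneSpectrum (𝓞 K)) (hv : v.asIdeal = Ideal.span {π₃''})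
    {z : K} (hz : z ≠ 0) : log (v.valuation K z) = -(κpos z).valuation :=
  log_valuation_eq_neg_valuation_embedding (κpos : K →ₐ[ℚ] ℚ_[3]).toRingHom span_π₃''_isMaximal
    valuation_κpos_π₃'' v hv hz

/-! ### The dictionary at the inert prime: `2 ord_(5) = v₅ ∘ N` -/

/-- Galois conjugation on `𝓞 K` (`√73 ↦ -√73`). [folklore] -/
def conjInt : 𝓞 K →+* 𝓞 K := NumberField.RingOfIntegers.mapRingHom (starRingEnd K)

/-- The conjugate in `K`. [folklore] -/
theorem coe_conjInt (w : 𝓞 K) : ((conjInt w : 𝓞 K) : K) = star (w : K) := rfl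

/-- Conjugation is an involution. [folklore] -/
theorem conjInt_conjInt (w : 𝓞 K) : conjInt (conjInt w) = w := by
  apply RingOfIntegers.coe_injective
  show ((conjInt (conjInt w) : 𝓞 K) : K) = (w : K)
  rw [coe_conjInt, coe_conjInt, star_star]

/-- `N(w) = w · w̄` in `𝓞 K`. [folklore] -/
theorem intCast_norm_eq_mul_conj (w : 𝓞 K) : ((Algebra.norm ℤ w : ℤ) : 𝓞 K) = w * conjInt w := by
  apply RingOfIntegers.coe_injective
  rw [map_mul, map_intCast]
  change ((Algebra.norm ℤ w : ℤ) : K) = (w : K) * star (w : K)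
  rw [← algebraMap_norm_eq_mul_star, ← algNorm_eq_norm, ← Algebra.coe_norm_int, map_intCast]

/-- **`5 ∣ N(w) ⟹ 5 ∣ w`** (`5` is a prime element and `N(w) = w w̄`). [folklore] -/
theorem five_dvd_of_dvd_norm {w : 𝓞 K} (h : (5 : ℤ) ∣ Algebra.norm ℤ w) : (5 : 𝓞 K) ∣ w := by
  have h1 : (5 : 𝓞 K) ∣ w * conjInt w := by
    rw [← intCast_norm_eq_mul_conj]
    obtain ⟨c, hc⟩ := h
    exact ⟨c, by rw [hc]; push_cast; ring⟩
  rcases prime_five.dvd_or_dvd h1 with h2 | h2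
  · exact h2
  · obtain ⟨c, hc⟩ := h2
    refine ⟨conjInt c, ?_⟩
    rw [← conjInt_conjInt w, hc, map_mul, map_ofNat]

/-- `N(5) = 25`. [folklore] -/
theorem algNorm_five : Algebra.norm ℚ (5 : K) = 25 := by
  rw [show (5 : K) = algebraMap ℚ K 5 by simp [map_ofNat], Algebra.norm_algebraMap, finrank_eq_two]
  norm_num

/-- **`2 ord_(5) r = v₅(N r)`** for `r ∈ 𝓞 K`, `r ≠ 0`: write `r = 5ᵏ w` with `5 ∤ w`; then
`ord_(5) r = k` and `N(r) = 25ᵏ N(w)` with `5 ∤ N(w)`. [folklore] -/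
theorem two_mul_log_intValuation_five (v : HeightOneSpectrum (𝓞 K))
    (hv : v.asIdeal = Ideal.span {(5 : 𝓞 K)}) {r : 𝓞 K} (hr : r ≠ 0) :
    2 * log (v.intValuation r) = -padicValRat 5 (Algebra.norm ℚ (r : K)) := by
  obtain ⟨k, w, hw, rfl⟩ := WfDvdMonoid.max_power_factor' hr prime_five.not_unit
  have hw0 : w ≠ 0 := by rintro rfl; exact hr (mul_zero _)
  -- ideal side
  have hv5 : v.intValuation (5 : 𝓞 K) = exp (-1 : ℤ) := intValuation_singleton _ (by norm_num) hv
  have hvw : v.intValuation w = 1 := by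
    rw [intValuation_eq_one_iff, hv, Ideal.mem_span_singleton]; exact hw
  have h1 : log (v.intValuation (5 ^ k * w)) = -k := by
    rw [map_mul, map_pow, hv5, hvw, mul_one, ← exp_nsmul, log_exp]; simp
  -- norm side
  have hN : Algebra.norm ℚ (((5 ^ k * w : 𝓞 K)) : K) = 25 ^ k * (Algebra.norm ℤ w : ℚ) := by
    rw [show (((5 ^ k * w : 𝓞 K)) : K) = (5 : K) ^ k * (w : K) by push_cast; rfl, map_mul, map_pow,
      algNorm_five, Algebra.coe_norm_int]
  have hndvd : ¬ (5 : ℤ) ∣ Algebra.norm ℤ w := fun h5 => hw (five_dvd_of_dvd_norm h5)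
  have hvN : padicValRat 5 ((Algebra.norm ℤ w : ℤ) : ℚ) = 0 := by
    rw [padicValRat.of_int, padicValInt.eq_zero_of_not_dvd hndvd, Nat.cast_zero]
  have hN0 : ((Algebra.norm ℤ w : ℤ) : ℚ) ≠ 0 := by
    rw [Int.cast_ne_zero, Algebra.norm_ne_zero_iff]; exact hw0
  have h25 : padicValRat 5 ((25 : ℚ) ^ k) = 2 * k := by
    rw [padicValRat.pow, show (25 : ℚ) = ((5 : ℕ) : ℚ) ^ 2 by norm_num, padicValRat.pow,
      padicValRat.self (by norm_num)]
    ring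
  rw [h1, hN, padicValRat.mul (pow_ne_zero _ (by norm_num)) hN0, h25, hvN]
  ring

/-- **`2 ord_(5) z = v₅(N z)`** for `z ∈ Kˣ`. [folklore] -/
theorem two_mul_log_valuation_five (v : HeightOneSpectrum (𝓞 K))
    (hv : v.asIdeal = Ideal.span {(5 : 𝓞 K)}) {z : K} (hz : z ≠ 0) :
    2 * log (v.valuation K z) = -padicValRat 5 (Algebra.norm ℚ z) := by
  obtain ⟨a, b, hb, rfl⟩ := IsFractionRing.div_surjective (A := 𝓞 K) z
  have hb0 : b ≠ 0 := nonZeroDivisors.ne_zero hb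
  have ha0 : a ≠ 0 := by
    rintro rfl; rw [map_zero, zero_div] at hz; exact hz rfl
  have hva : v.intValuation a ≠ 0 := v.intValuation_ne_zero a ha0
  have hvb : v.intValuation b ≠ 0 := v.intValuation_ne_zero b hb0
  have hbK : algebraMap (𝓞 K) K b ≠ 0 := RingOfIntegers.coe_ne_zero_iff.mpr hb0
  have hNb : Algebra.norm ℚ (algebraMap (𝓞 K) K b) ≠ 0 := Algebra.norm_ne_zero_iff.mpr hbK
  have hNz : Algebra.norm ℚ (algebraMap (𝓞 K) K a / algebraMap (𝓞 K) K b) ≠ 0 :=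
    Algebra.norm_ne_zero_iff.mpr hz
  have hmul : Algebra.norm ℚ (algebraMap (𝓞 K) K a / algebraMap (𝓞 K) K b) *
      Algebra.norm ℚ (algebraMap (𝓞 K) K b) = Algebra.norm ℚ (algebraMap (𝓞 K) K a) := by
    rw [← map_mul, div_mul_cancel₀ _ hbK]
  have hvp := congrArg (padicValRat 5) hmul
  rw [padicValRat.mul hNz hNb] at hvp
  rw [Valuation.map_div, valuation_of_algebraMap, valuation_of_algebraMap, log_div hva hvb, mul_sub,
    two_mul_log_intValuation_five v hv ha0, two_mul_log_intValuation_five v hv hb0]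
  rw [← RingOfIntegers.coe_eq_algebraMap, ← RingOfIntegers.coe_eq_algebraMap] at hvp
  rw [← RingOfIntegers.coe_eq_algebraMap, ← RingOfIntegers.coe_eq_algebraMap]
  linarith

/-! ### The square theorem in local terms -/

/-- **The square theorem for `K = ℚ(√73)` in local terms.** Let `z ∈ Kˣ` have even valuation at
every prime not dividing `30`; suppose `v₂(ι⁺ z)`, `v₂(ι⁻ z)`, `v₃(κ⁺ z)`, `v₃(κ⁻ z)` are even,
`4 ∣ v₅(N z)`, and `σ⁺ z, σ⁻ z > 0`. Then `z` is a square in `K`. (Class number one, totally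
positive units are squares, and the dictionary between the primes above `2, 3, 5` and the
embeddings / the norm.) [folklore] -/
theorem exists_sq_eq_of_local_data {z : K} (hz : z ≠ 0)
    (hS : ∀ v : HeightOneSpectrum (𝓞 K), (30 : 𝓞 K) ∉ v.asIdeal → (2 : ℤ) ∣ log (v.valuation K z))
    (h2p : Even (ιpos z).valuation) (h2n : Even (ιneg z).valuation)
    (h3p : Even (κpos z).valuation) (h3n : Even (κneg z).valuation)
    (h5 : (4 : ℤ) ∣ padicValRat 5 (Algebra.norm ℚ z))
    (hpos : 0 < σpos z) (hpos' : 0 < σneg z) : ∃ w : K, z = w ^ 2 := by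
  refine isSquare_of_forall_two_dvd_of_pos hz (fun v => ?_) hpos hpos'
  by_cases h30 : (30 : 𝓞 K) ∈ v.asIdeal
  swap
  · exact hS v h30
  have hP := v.isPrime
  rw [show (30 : 𝓞 K) = 2 * 3 * 5 by norm_num] at h30
  rcases hP.mem_or_mem h30 with h23 | h5'
  · rcases hP.mem_or_mem h23 with h2 | h3'
    · rcases eq_span_of_isPrime_of_two_mem hP h2 with hv | hv
      · rw [log_valuation_span_π₂ v hv hz]
        exact (even_neg.mpr h2n).two_dvd
      · rw [log_valuation_span_π₂' v hv hz]
        exact (even_neg.mpr h2p).two_dvd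
    · rcases eq_span_of_isPrime_of_three_mem hP h3' with hv | hv
      · rw [log_valuation_span_π₃ v hv hz]
        exact (even_neg.mpr h3n).two_dvd
      · rw [log_valuation_span_π₃'' v hv hz]
        exact (even_neg.mpr h3p).two_dvd
  · have hv := eq_span_five hP h5'
    have h := two_mul_log_valuation_five v hv hz
    obtain ⟨m, hm⟩ := h5
    exact ⟨-m, by omega⟩

end Literature.NumberTheory.QuadraticFields.Sqrt73

end
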